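import Literature.MathematicalPhysics.QuantumLattice.RepLieAlgebra
import Mathlib.LinearAlgebra.Complex.Module
import Mathlib.LinearAlgebra.Dimension.Constructions
import Mathlib.LinearAlgebra.Dimension.Free

/-!
# Crux `BrascampLiebVacuumSC` (stmt-QuantumFields-16404), line `SketchIdeator1`, skeleton v8:
# the real structure of the complexification of a skew-Hermitian real subspace of `M_N(ℂ)`

Helper toward the glue `stub_involutionGlue` (lead c4). The three Lie-theoretic stubs
`stub_weightDecomp`, `stub_abelianThird`, `stub_involutionSplit` of skeleton v8 take as a hypothesis
the "real structure" of the complex span `L_ℂ := Submodule.span ℂ L` of a real subspace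
`L ⊆ 𝔲(N) = {X : star X = -X}` of `M_N(ℂ)`:

* (RS1) for every skew-Hermitian real subspace `W`, `dim_ℂ (span ℂ W) = dim_ℝ W`
  (a real basis of `W` is a complex basis of `W_ℂ`: `RealStructure.finrank_span_complex_eq`);
* (RS2) every `Z ∈ L_ℂ` is `X + I • Y` with `X, Y ∈ L` (`RealStructure.exists_add_I_smul_of_mem_span`,
  true for any real subspace);
* (RS3) `X + I • Y = 0` with `X, Y` skew-Hermitian forces `X = Y = 0` (apply `star`:
  `-X + I • Y = 0`; `RealStructure.eq_zero_of_add_I_smul_eq_zero`) — i.e. `𝔲(N) ∩ i𝔲(N) = 0`,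
  `M_N(ℂ) = 𝔲(N) ⊕ i𝔲(N)`.

`stub_realStructure` (registered sub-goal of the crux, toward `stub_involutionGlue`) packages the three in
exactly the shape of that hypothesis. Elementary linear
algebra; no named facts are used.
-/

set_option autoImplicit false

open scoped BigOperators Matrix

noncomputable section

namespace Summit.QuantumFields.YangMills.Theorems.BrascampLiebVacuumSC

namespace RealStructure

variable {N : ℕ}

/-- Real scalars act on `M_N(ℂ)` through `ℝ ⊆ ℂ`: `(a : ℂ) • X = a • X`. [folklore] -/
theorem coe_smul (a : ℝ) (X : Matrix (Fin N) (Fin N) ℂ) : (a : ℂ) • X = a • X := by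
  ext i j
  simp only [Matrix.smul_apply, smul_eq_mul, Complex.real_smul]

/-- For a skew-Hermitian `Y`, `star (I • Y) = I • Y` (`star I = -I`). [folklore] -/
theorem star_I_smul {Y : Matrix (Fin N) (Fin N) ℂ} (hY : star Y = -Y) :
    star (Complex.I • Y) = Complex.I • Y := by
  rw [star_smul, hY, Complex.star_def, Complex.conj_I, smul_neg, neg_smul, neg_neg]

/-- **(RS3)** For skew-Hermitian `X, Y ∈ M_N(ℂ)`: `X + I • Y = 0` forces `X = 0` and `Y = 0`
(applying `star` gives `-X + I • Y = 0`, so `2 I • Y = 0`). [folklore] -/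
theorem eq_zero_of_add_I_smul_eq_zero {X Y : Matrix (Fin N) (Fin N) ℂ} (hX : star X = -X)
    (hY : star Y = -Y) (h : X + Complex.I • Y = 0) : X = 0 ∧ Y = 0 := by
  have h2 : -X + Complex.I • Y = 0 := by
    have hs := congrArg star h
    rwa [star_add, star_I_smul hY, hX, star_zero] at hs
  have hXe : X = -(Complex.I • Y) := eq_neg_of_add_eq_zero_left h
  rw [hXe, neg_neg, ← two_smul ℂ, smul_smul] at h2
  have hY0 : Y = 0 :=
    (smul_eq_zero.mp h2).resolve_left (mul_ne_zero two_ne_zero Complex.I_ne_zero)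
  refine ⟨?_, hY0⟩
  rw [hXe, hY0, smul_zero, neg_zero]

/-- The complex-linear combination `c • (X + I • Y)` in real coordinates:
`(re c • X − im c • Y) + I • (im c • X + re c • Y)`. [folklore] -/
theorem smul_add_I_smul (c : ℂ) (X Y : Matrix (Fin N) (Fin N) ℂ) :
    c • (X + Complex.I • Y) = (c.re • X - c.im • Y) + Complex.I • (c.im • X + c.re • Y) := by
  ext i j
  simp only [Matrix.smul_apply, Matrix.add_apply, Matrix.sub_apply, smul_eq_mul, Complex.real_smul]
  apply Complex.ext
  · simp only [Complex.mul_re, Complex.mul_im, Complex.add_re, Complex.add_im, Complex.sub_re,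
      Complex.ofReal_re, Complex.ofReal_im, Complex.I_re, Complex.I_im]
    ring
  · simp only [Complex.mul_re, Complex.mul_im, Complex.add_re, Complex.add_im, Complex.sub_im,
      Complex.ofReal_re, Complex.ofReal_im, Complex.I_re, Complex.I_im]
    ring

/-- **(RS2)** Every element of the complex span of a real subspace `L ⊆ M_N(ℂ)` is `X + I • Y`
with `X, Y ∈ L` (`span ℂ L = L + iL`). [folklore] -/
theorem exists_add_I_smul_of_mem_span (L : Submodule ℝ (Matrix (Fin N) (Fin N) ℂ))
    {Z : Matrix (Fin N) (Fin N) ℂ}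
    (hZ : Z ∈ Submodule.span ℂ (L : Set (Matrix (Fin N) (Fin N) ℂ))) :
    ∃ X ∈ L, ∃ Y ∈ L, Z = X + Complex.I • Y := by
  induction hZ using Submodule.span_induction with
  | mem Z hZ => exact ⟨Z, hZ, 0, L.zero_mem, by rw [smul_zero, add_zero]⟩
  | zero => exact ⟨0, L.zero_mem, 0, L.zero_mem, by rw [smul_zero, add_zero]⟩
  | add Z Z' _ _ hZ hZ' =>
    obtain ⟨X, hX, Y, hY, rfl⟩ := hZ
    obtain ⟨X', hX', Y', hY', rfl⟩ := hZ'
    exact ⟨X + X', L.add_mem hX hX', Y + Y', L.add_mem hY hY', by rw [smul_add]; abel⟩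
  | smul c Z _ hZ =>
    obtain ⟨X, hX, Y, hY, rfl⟩ := hZ
    exact ⟨c.re • X - c.im • Y, L.sub_mem (L.smul_mem _ hX) (L.smul_mem _ hY),
      c.im • X + c.re • Y, L.add_mem (L.smul_mem _ hX) (L.smul_mem _ hY), smul_add_I_smul c X Y⟩

/-- **(RS1)** For a real subspace `W` of skew-Hermitian matrices the complex span
`W_ℂ = W ⊕ iW` has complex dimension `dim_ℝ W`: a real basis of `W` stays `ℂ`-linearly
independent (a complex relation splits into two real ones by (RS3)) and spans `W_ℂ`. [folklore] -/
theorem finrank_span_complex_eq (W : Submodule ℝ (Matrix (Fin N) (Fin N) ℂ))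
    (hW : ∀ X ∈ W, star X = -X) :
    Module.finrank ℂ ↥(Submodule.span ℂ (W : Set (Matrix (Fin N) (Fin N) ℂ))) =
      Module.finrank ℝ ↥W := by
  set b := Module.finBasis ℝ ↥W
  set v : Fin (Module.finrank ℝ ↥W) → Matrix (Fin N) (Fin N) ℂ :=
    fun i => ((b i : ↥W) : Matrix (Fin N) (Fin N) ℂ) with hv
  -- real independence of `v = W.subtype ∘ b`
  have hvR : LinearIndependent ℝ v := b.linearIndependent.map' W.subtype W.ker_subtype
  -- complex independence
  have hvC : LinearIndependent ℂ v := by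
    rw [Fintype.linearIndependent_iff]
    intro g hg i
    have hX : ∑ k, (g k).re • v k ∈ W := W.sum_mem fun k _ => W.smul_mem _ (b k).2
    have hY : ∑ k, (g k).im • v k ∈ W := W.sum_mem fun k _ => W.smul_mem _ (b k).2
    have hsplit : (∑ k, (g k).re • v k) + Complex.I • (∑ k, (g k).im • v k) = ∑ k, g k • v k := by
      rw [Finset.smul_sum, ← Finset.sum_add_distrib]
      refine Finset.sum_congr rfl fun k _ => ?_
      rw [← coe_smul, ← coe_smul, smul_smul, ← add_smul, mul_comm Complex.I, Complex.re_add_im]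
    rw [hg] at hsplit
    obtain ⟨h1, h2⟩ := eq_zero_of_add_I_smul_eq_zero (hW _ hX) (hW _ hY) hsplit
    have hre : (g i).re = 0 := Fintype.linearIndependent_iff.mp hvR (fun k => (g k).re) h1 i
    have him : (g i).im = 0 := Fintype.linearIndependent_iff.mp hvR (fun k => (g k).im) h2 i
    exact Complex.ext hre him
  -- the spans agree
  have hspan : Submodule.span ℂ (Set.range v) =
      Submodule.span ℂ (W : Set (Matrix (Fin N) (Fin N) ℂ)) := by
    apply le_antisymm
    · exact Submodule.span_mono (Set.range_subset_iff.mpr fun k => (b k).2)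
    · rw [Submodule.span_le]
      intro w hw
      have hw' : w = ∑ k, (b.repr ⟨w, hw⟩ k) • v k := by
        have h := congrArg W.subtype (b.sum_repr ⟨w, hw⟩)
        rw [map_sum] at h
        simpa only [map_smul, Submodule.subtype_apply] using h.symm
      rw [SetLike.mem_coe, hw']
      refine Submodule.sum_mem _ fun k _ => ?_
      rw [← coe_smul]
      exact Submodule.smul_mem _ _ (Submodule.subset_span (Set.mem_range_self k))
  rw [← hspan, finrank_span_eq_card hvC, Fintype.card_fin]

end RealStructure

/-- **The real structure of the complexification `L_ℂ = L ⊕ iL` of a real subspace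
`L ⊆ 𝔲(N)` of `M_N(ℂ)`** — the hypothesis `hRS` of `stub_weightDecomp` / `stub_abelianThird` /
`stub_involutionSplit` of skeleton v8, proved: (RS1) `dim_ℂ (span ℂ W) = dim_ℝ W` for every
skew-Hermitian real subspace `W`; (RS2) `span ℂ L = L + I • L`; (RS3) `L ∩ I • L = 0` in the form
`X + I • Y = 0 → X = 0 ∧ Y = 0`. [folklore] -/
theorem stub_realStructure :
    ∀ (N : ℕ) (L : Submodule ℝ (Matrix (Fin N) (Fin N) ℂ)), (∀ X ∈ L, star X = -X) →
      ((∀ W : Submodule ℝ (Matrix (Fin N) (Fin N) ℂ), (∀ X ∈ W, star X = -X) →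
          Module.finrank ℂ ↥(Submodule.span ℂ (W : Set (Matrix (Fin N) (Fin N) ℂ))) = Module.finrank ℝ ↥W) ∧
        (∀ Z ∈ Submodule.span ℂ (L : Set (Matrix (Fin N) (Fin N) ℂ)), ∃ X ∈ L, ∃ Y ∈ L, Z = X + Complex.I • Y) ∧
        (∀ X ∈ L, ∀ Y ∈ L, X + Complex.I • Y = 0 → X = 0 ∧ Y = 0)) :=
  fun _N L hL =>
    ⟨fun W hW => RealStructure.finrank_span_complex_eq W hW,
      fun _Z hZ => RealStructure.exists_add_I_smul_of_mem_span L hZ,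
      fun X hX Y hY h => RealStructure.eq_zero_of_add_I_smul_eq_zero (hL X hX) (hL Y hY) h⟩

end Summit.QuantumFields.YangMills.Theorems.BrascampLiebVacuumSC

end
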